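import Literature.Geometry.Kaehler.ComplexTorusProductFamilyOfPolarizedIso
import Literature.Geometry.Kaehler.ComplexTorusIrreduciblePrincipallyPolarized
import HarnessLib

/-!
# Uniqueness of the decomposition of a polarised torus into indecomposable factors, externally
# (Debarre 1996, Corollaire 2 b) / Clemens–Griffiths 1972, Cor. 3.23, for products of polarised tori)

Layer `Literature/Geometry/Kaehler`, namespace `Literature.Geometry.Kaehler.ComplexTorus`; lane `lit-hodgefound`
(Track 2 foundations library), skeleton seat `lit-hodgefound-skel-2` (generation 35), plan row A2-131 — sequel of
A2-130 (`ComplexTorusProductFamilyOfPolarizedIso`: an isomorphism of polarised tori `h : (X, η) ⥲ (∏_k X_k, ⊞_k ω_k)`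
yields a product family `(V_k)_k` of `(X, η)` with `(Y_{V_k}, η|) ≅ (X_k, ω_k)`) and of p26's INTERNAL uniqueness
(`IsProductFamily.range_eq_polarizedComponents`, `debarre1996_corollaire_2b` in
`ComplexTorusPolarizedDecompositionUnique`). THEOREMS ONLY (no definition, no named fact, net debt `0`).

## Sources, VERBATIM

O. Debarre, *Polarisations sur les variétés abéliennes produits*, C. R. Acad. Sci. Paris **323** (1996)
[Debarre1996PolarisationsProduits], Corollaire 2: "Soit `(X, θ)` une variété abélienne polarisée. a) […] b) Si
`(X_1, θ|_{X_1}), …, (X_r, θ|_{X_r})` et `(Y_1, θ|_{Y_1}), …, (Y_s, θ|_{Y_s})` sont indécomposables, on a `r = s` et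
il existe une permutation `σ` de `{1, …, s}` telle que `Y_j = X_{σ(j)}` pour tout `j`." (p. 631: «indécomposable»
= non nulle et non isomorphe au produit de deux variétés abéliennes polarisées non nulles.)

C. H. Clemens, P. A. Griffiths, *The intermediate Jacobian of the cubic threefold*, Ann. of Math. **95** (1972),
§3 p. 297 [ClemensGriffiths1972]: "**COROLLARY 3.23.** If `𝒯` is a principally polarized abelian variety, `𝒯` has
a unique decomposition into the direct sum of irreducible principally polarized abelian varieties."

## What this file proves

For an isomorphism of polarised tori `h : (X, η) ⥲ (∏_k X_k, ⊞_k ω_k)` (`IsPolarizedIso Φ η (sigmaPiPeriod Ψ)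
(piForm ω) h`, any index types / model spaces) whose factors `(X_k, ω_k)` are INDECOMPOSABLE (non-zero, `σ_k ≠ ∅`,
and not a product of two non-zero polarised tori, `¬ IsPolarizedDecomposable`):

* §1 `exists_isPolarizedIso_subtorus_of_eq` (equal sub-lattice spaces carry identically polarised sub-tori);
  **`IsPolarizedIso.exists_isProductFamily_isIndecomposable`**: the internal images `V_k` (A2-130) are
  indecomposable (`IsIndecomposable Φ η (V_k)`, p26), with `h(Y_{V_k}) =` the `k`-th axis and
  `(Y_{V_k}, η|) ≅ (X_k, ω_k)`; the same from IRREDUCIBLE p.p.a.v. factors (Def. 3.22,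
  `…_of_isPolarizedIrreducible`).
* §2 **UNIQUENESS**: `IsPolarizedIso.exists_range_eq_polarizedComponents` (`{V_k} = polarizedComponents Φ η`,
  `V` injective), **`IsPolarizedIso.card_eq_ncard_polarizedComponents`** (the NUMBER of indecomposable factors of
  any external decomposition is `#polarizedComponents`), and **`IsPolarizedIso.exists_equiv_isPolarizedIso`** —
  DEBARRE'S COR. 2 b) / C–G COR. 3.23 EXTERNALLY: two decompositions `(X, η) ≅ ∏_{k ∈ κ} (X_k, ω_k) ≅
  ∏_{j ∈ κ′} (X′_j, ω′_j)` into indecomposables admit a bijection `e : κ ≃ κ′` with `(X_k, ω_k) ≅ (X′_{e k}, ω′_{e k})`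
  as polarised tori (and equal internal images); `…_of_isPolarizedIrreducible` for irreducible p.p.a.v. factors.
* §3 **the product itself**: `exists_isPolarizedIso_sigmaAxisSubspace` (the axis `0 × ⋯ × X_k × ⋯ × 0` with
  `⊞ ω|` is `≅ (X_k, ω_k)`), `isIndecomposable_sigmaAxisSubspace`, **`polarizedComponents_sigmaPi`** (the polarised
  components of a product of indecomposables ARE the axes), **`ncard_polarizedComponents_sigmaPi`** (`= #κ`),
  `polarizedComponents_sigmaPi_of_isPolarizedIrreducible`.
-- TODO(general form): none.

## References

* [Debarre1996PolarisationsProduits] O. Debarre, C. R. Acad. Sci. Paris Sér. I **323** (1996) 631–635,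
  Corollaire 2 b).
* [ClemensGriffiths1972] C. H. Clemens, P. A. Griffiths, Ann. of Math. 95 (1972), §3 Def. 3.22, Cor. 3.23, p. 297.
* [Lange2023AbelianVarietiesComplex] H. Lange, *Abelian Varieties over the Complex Numbers* (2023), §2.4.4
  Cor. 2.4.31, §3.1.2 Prop. 3.1.4.
-/

noncomputable section

open Function Module Matrix Finset

namespace Literature.Geometry.Kaehler

universe u

namespace ComplexTorus

variable {ι : Type*} [Fintype ι] [DecidableEq ι] {E : Type*} [NormedAddCommGroup E] [NormedSpace ℂ E]
  {Φ : (ι → ℝ) ≃L[ℝ] E} {η : E [⋀^Fin 2]→L[ℝ] ℝ}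

/-! ### §1 The internal images of indecomposable external factors are indecomposable -/

section Indecomposable

omit [DecidableEq ι] in
/-- **Equal sub-lattice spaces carry identically polarised sub-tori**: for `U = U′` the identity is an isomorphism
of polarised tori `(Y_U, η|_U) ⥲ (Y_{U′}, η|_{U′})` (bookkeeping of the proof terms in `subtorusPeriod`).
[cite: Lange2023AbelianVarietiesComplex, §3.1.2 (isomorphisms of polarized abelian varieties), p. 158] -/
theorem exists_isPolarizedIso_subtorus_of_eq {U U' : Submodule ℝ (ι → ℝ)} (hUU' : U = U')
    (hU : IsLatticeSubspace U) (hUc : IsComplexSubspace Φ U) (hU' : IsLatticeSubspace U')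
    (hUc' : IsComplexSubspace Φ U') :
    ∃ f : ComplexTorus (subtorusPeriod Φ U hU hUc) ≃+ ComplexTorus (subtorusPeriod Φ U' hU' hUc'),
      IsPolarizedIso (subtorusPeriod Φ U hU hUc) (pullbackForm (cxSpan Φ U).subtypeL η)
        (subtorusPeriod Φ U' hU' hUc') (pullbackForm (cxSpan Φ U').subtypeL η) f := by
  subst hUU'
  exact ⟨AddEquiv.refl _, IsPolarizedIso.refl _ _⟩

variable {κ : Type*} [Fintype κ] [DecidableEq κ] {σ : κ → Type*} [∀ k, Fintype (σ k)] [∀ k, DecidableEq (σ k)]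
  {F : κ → Type*} [∀ k, NormedAddCommGroup (F k)] [∀ k, NormedSpace ℂ (F k)]
  {Ψ : ∀ k, (σ k → ℝ) ≃L[ℝ] F k} {ω : ∀ k, F k [⋀^Fin 2]→L[ℝ] ℝ}
  {h : ComplexTorus Φ ≃+ ComplexTorus (sigmaPiPeriod Ψ)}

/-- **The internal images of INDECOMPOSABLE external factors are indecomposable.** For an isomorphism of polarised
tori `h : (X, η) ⥲ (∏_k X_k, ⊞_k ω_k)` whose factors are non-zero and not products of two non-zero polarised tori, the
product family `(V_k)_k` of A2-130 consists of indecomposable members (p26's `IsIndecomposable`), `h(Y_{V_k})` is the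
`k`-th axis and `(Y_{V_k}, η|) ≅ (X_k, ω_k)`. [cite: Debarre1996PolarisationsProduits, p. 631 («indécomposable») and Corollaire 2]
[cite: Lange2023AbelianVarietiesComplex, §2.4.4 Cor. 2.4.31, p. 125] -/
theorem IsPolarizedIso.exists_isProductFamily_isIndecomposable [∀ k, Nonempty (σ k)]
    (hh : IsPolarizedIso Φ η (sigmaPiPeriod Ψ) (piForm ω) h) (hind : ∀ k, ¬ IsPolarizedDecomposable (Ψ k) (ω k)) :
    ∃ V : κ → Submodule ℝ (ι → ℝ), ∃ hF : IsProductFamily Φ η V,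
      (∀ k, IsIndecomposable Φ η (V k)) ∧
      (∀ k, h '' (proj Φ '' (V k : Set (ι → ℝ))) = {t | ∀ j, j ≠ k → sigmaPiHomeomorph Ψ t j = 0}) ∧
      ∀ k, ∃ g : ComplexTorus (subtorusPeriod Φ (V k) (hF.isLatticeSubspace k) (hF.isComplexSubspace k)) ≃+
          ComplexTorus (Ψ k),
        IsPolarizedIso (subtorusPeriod Φ (V k) (hF.isLatticeSubspace k) (hF.isComplexSubspace k))
          (pullbackForm (cxSpan Φ (V k)).subtypeL η) (Ψ k) (ω k) g := by
  obtain ⟨V, hF, himg, hbot, hiso⟩ := hh.exists_isProductFamily_sigmaPi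
  refine ⟨V, hF, fun k ↦ ?_, himg, hiso⟩
  obtain ⟨g, hg⟩ := hiso k
  rw [isIndecomposable_iff_not_isPolarizedDecomposable (hF.isLatticeSubspace k) (hF.isComplexSubspace k)]
  exact ⟨fun h0 ↦ (not_isEmpty_of_nonempty (σ k)) ((hbot k).1 h0),
    fun hd ↦ hind k (hg.isPolarizedDecomposable_iff.1 hd)⟩

/-- The same for a decomposition into non-zero IRREDUCIBLE PRINCIPALLY POLARISED factors (Definition 3.22; for a
p.p.a.v., irreducible ⟺ not decomposable, A2-123). [cite: ClemensGriffiths1972, §3 Def. 3.22 and Cor. 3.23, p. 297] -/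
theorem IsPolarizedIso.exists_isProductFamily_isIndecomposable_of_isPolarizedIrreducible [∀ k, Nonempty (σ k)]
    (hh : IsPolarizedIso Φ η (sigmaPiPeriod Ψ) (piForm ω) h) (hPk : ∀ k, IsPrincipalPolarization (Ψ k) (ω k))
    (hirr : ∀ k, IsPolarizedIrreducible (Ψ k) (ω k)) :
    ∃ V : κ → Submodule ℝ (ι → ℝ), ∃ hF : IsProductFamily Φ η V,
      (∀ k, IsIndecomposable Φ η (V k)) ∧
      (∀ k, h '' (proj Φ '' (V k : Set (ι → ℝ))) = {t | ∀ j, j ≠ k → sigmaPiHomeomorph Ψ t j = 0}) ∧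
      ∀ k, ∃ g : ComplexTorus (subtorusPeriod Φ (V k) (hF.isLatticeSubspace k) (hF.isComplexSubspace k)) ≃+
          ComplexTorus (Ψ k),
        IsPolarizedIso (subtorusPeriod Φ (V k) (hF.isLatticeSubspace k) (hF.isComplexSubspace k))
          (pullbackForm (cxSpan Φ (V k)).subtypeL η) (Ψ k) (ω k) g :=
  hh.exists_isProductFamily_isIndecomposable fun k ↦
    ((hPk k).isPolarizedIrreducible_iff_not_isPolarizedDecomposable (Ψ k)).1 (hirr k)

end Indecomposable

/-! ### §2 Uniqueness: the factors of any external decomposition into indecomposables are the polarised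
components; two such decompositions are equivalent -/

section Unique

variable {κ : Type*} [Fintype κ] [DecidableEq κ] {σ : κ → Type*} [∀ k, Fintype (σ k)] [∀ k, DecidableEq (σ k)]
  {F : κ → Type*} [∀ k, NormedAddCommGroup (F k)] [∀ k, NormedSpace ℂ (F k)]
  {Ψ : ∀ k, (σ k → ℝ) ≃L[ℝ] F k} {ω : ∀ k, F k [⋀^Fin 2]→L[ℝ] ℝ}
  {h : ComplexTorus Φ ≃+ ComplexTorus (sigmaPiPeriod Ψ)}
  {κ' : Type*} [Fintype κ'] [DecidableEq κ'] {σ' : κ' → Type*} [∀ j, Fintype (σ' j)] [∀ j, DecidableEq (σ' j)]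
  {F' : κ' → Type*} [∀ j, NormedAddCommGroup (F' j)] [∀ j, NormedSpace ℂ (F' j)]
  {Ψ' : ∀ j, (σ' j → ℝ) ≃L[ℝ] F' j} {ω' : ∀ j, F' j [⋀^Fin 2]→L[ℝ] ℝ}
  {h' : ComplexTorus Φ ≃+ ComplexTorus (sigmaPiPeriod Ψ')}

/-- **THE FACTORS OF ANY EXTERNAL DECOMPOSITION INTO INDECOMPOSABLES ARE THE POLARISED COMPONENTS**: for a
polarised torus `(X, η)` and `h : (X, η) ⥲ (∏_k X_k, ⊞_k ω_k)` with indecomposable factors, the internal images form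
an INJECTIVE family with range `polarizedComponents Φ η` (p26's canonical set of indecomposable factors).
[cite: Debarre1996PolarisationsProduits, Corollaire 2 b)] -/
theorem IsPolarizedIso.exists_range_eq_polarizedComponents [∀ k, Nonempty (σ k)]
    (hh : IsPolarizedIso Φ η (sigmaPiPeriod Ψ) (piForm ω) h) (hind : ∀ k, ¬ IsPolarizedDecomposable (Ψ k) (ω k))
    (hη : IsRiemannForm Φ η) :
    ∃ V : κ → Submodule ℝ (ι → ℝ), ∃ hF : IsProductFamily Φ η V,
      (∀ k, IsIndecomposable Φ η (V k)) ∧ Set.range V = polarizedComponents Φ η ∧ Injective V ∧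
      (∀ k, h '' (proj Φ '' (V k : Set (ι → ℝ))) = {t | ∀ j, j ≠ k → sigmaPiHomeomorph Ψ t j = 0}) ∧
      ∀ k, ∃ g : ComplexTorus (subtorusPeriod Φ (V k) (hF.isLatticeSubspace k) (hF.isComplexSubspace k)) ≃+
          ComplexTorus (Ψ k),
        IsPolarizedIso (subtorusPeriod Φ (V k) (hF.isLatticeSubspace k) (hF.isComplexSubspace k))
          (pullbackForm (cxSpan Φ (V k)).subtypeL η) (Ψ k) (ω k) g := by
  obtain ⟨V, hF, hindV, himg, hiso⟩ := hh.exists_isProductFamily_isIndecomposable hind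
  exact ⟨V, hF, hindV, hF.range_eq_polarizedComponents hindV hη, hF.injective hindV hη, himg, hiso⟩

/-- **THE NUMBER OF INDECOMPOSABLE FACTORS IS AN INVARIANT: `#κ = #polarizedComponents`** for every external
decomposition `(X, η) ≅ ∏_{k ∈ κ} (X_k, ω_k)` into indecomposables («on a `r = s`»).
[cite: Debarre1996PolarisationsProduits, Corollaire 2 b)] [cite: ClemensGriffiths1972, §3 Cor. 3.23, p. 297] -/
theorem IsPolarizedIso.card_eq_ncard_polarizedComponents [∀ k, Nonempty (σ k)]
    (hh : IsPolarizedIso Φ η (sigmaPiPeriod Ψ) (piForm ω) h) (hind : ∀ k, ¬ IsPolarizedDecomposable (Ψ k) (ω k))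
    (hη : IsRiemannForm Φ η) : Fintype.card κ = (polarizedComponents Φ η).ncard := by
  obtain ⟨V, hF, hindV, hrange, hinj, -⟩ := hh.exists_range_eq_polarizedComponents hind hη
  rw [← hrange, Set.ncard_range_of_injective hinj, Nat.card_eq_fintype_card]

/-- **DEBARRE'S COROLLAIRE 2 b) / CLEMENS–GRIFFITHS' COR. 3.23, EXTERNALLY: two decompositions of a polarised
torus into indecomposable factors are equivalent.** If `(X, η) ≅ ∏_{k ∈ κ} (X_k, ω_k)` and
`(X, η) ≅ ∏_{j ∈ κ′} (X′_j, ω′_j)` as polarised tori, all factors indecomposable, there is a bijection `e : κ ≃ κ′`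
with equal internal images and `(X_k, ω_k) ≅ (X′_{e k}, ω′_{e k})` as polarised tori for every `k`.
[cite: Debarre1996PolarisationsProduits, Corollaire 2 b)] [cite: ClemensGriffiths1972, §3 Cor. 3.23, p. 297] -/
theorem IsPolarizedIso.exists_equiv_isPolarizedIso [∀ k, Nonempty (σ k)] [∀ j, Nonempty (σ' j)]
    (hh : IsPolarizedIso Φ η (sigmaPiPeriod Ψ) (piForm ω) h) (hh' : IsPolarizedIso Φ η (sigmaPiPeriod Ψ') (piForm ω') h')
    (hind : ∀ k, ¬ IsPolarizedDecomposable (Ψ k) (ω k)) (hind' : ∀ j, ¬ IsPolarizedDecomposable (Ψ' j) (ω' j))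
    (hη : IsRiemannForm Φ η) :
    ∃ e : κ ≃ κ', ∀ k, ∃ f : ComplexTorus (Ψ k) ≃+ ComplexTorus (Ψ' (e k)),
      IsPolarizedIso (Ψ k) (ω k) (Ψ' (e k)) (ω' (e k)) f := by
  obtain ⟨V, hF, hindV, -, hiso⟩ := hh.exists_isProductFamily_isIndecomposable hind
  obtain ⟨V', hF', hindV', -, hiso'⟩ := hh'.exists_isProductFamily_isIndecomposable hind'
  obtain ⟨e, he⟩ := debarre1996_corollaire_2b hF hF' hindV hindV' hη
  refine ⟨e, fun k ↦ ?_⟩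
  obtain ⟨g, hg⟩ := hiso k
  obtain ⟨g', hg'⟩ := hiso' (e k)
  obtain ⟨f₀, hf₀⟩ := exists_isPolarizedIso_subtorus_of_eq (η := η) (he k).symm (hF.isLatticeSubspace k)
    (hF.isComplexSubspace k) (hF'.isLatticeSubspace (e k)) (hF'.isComplexSubspace (e k))
  exact ⟨_, (hg.symm.trans hf₀).trans hg'⟩

/-- **COR. 3.23 externally, in Clemens–Griffiths' phrasing**: two decompositions of a polarised torus into
direct sums of non-zero IRREDUCIBLE principally polarised factors are equivalent — a bijection of the index sets with
isomorphic factors. [cite: ClemensGriffiths1972, §3 Def. 3.22 and Cor. 3.23, p. 297] -/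
theorem IsPolarizedIso.exists_equiv_isPolarizedIso_of_isPolarizedIrreducible [∀ k, Nonempty (σ k)]
    [∀ j, Nonempty (σ' j)]
    (hh : IsPolarizedIso Φ η (sigmaPiPeriod Ψ) (piForm ω) h) (hh' : IsPolarizedIso Φ η (sigmaPiPeriod Ψ') (piForm ω') h')
    (hPk : ∀ k, IsPrincipalPolarization (Ψ k) (ω k)) (hirr : ∀ k, IsPolarizedIrreducible (Ψ k) (ω k))
    (hPj : ∀ j, IsPrincipalPolarization (Ψ' j) (ω' j)) (hirr' : ∀ j, IsPolarizedIrreducible (Ψ' j) (ω' j))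
    (hη : IsRiemannForm Φ η) :
    ∃ e : κ ≃ κ', ∀ k, ∃ f : ComplexTorus (Ψ k) ≃+ ComplexTorus (Ψ' (e k)),
      IsPolarizedIso (Ψ k) (ω k) (Ψ' (e k)) (ω' (e k)) f :=
  hh.exists_equiv_isPolarizedIso hh'
    (fun k ↦ ((hPk k).isPolarizedIrreducible_iff_not_isPolarizedDecomposable (Ψ k)).1 (hirr k))
    (fun j ↦ ((hPj j).isPolarizedIrreducible_iff_not_isPolarizedDecomposable (Ψ' j)).1 (hirr' j)) hη

/-- The number of irreducible p.p.a.v. factors of any external decomposition of `(X, η)` is `#polarizedComponents`.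
[cite: ClemensGriffiths1972, §3 Cor. 3.23, p. 297] -/
theorem IsPolarizedIso.card_eq_ncard_polarizedComponents_of_isPolarizedIrreducible [∀ k, Nonempty (σ k)]
    (hh : IsPolarizedIso Φ η (sigmaPiPeriod Ψ) (piForm ω) h) (hPk : ∀ k, IsPrincipalPolarization (Ψ k) (ω k))
    (hirr : ∀ k, IsPolarizedIrreducible (Ψ k) (ω k)) (hη : IsRiemannForm Φ η) :
    Fintype.card κ = (polarizedComponents Φ η).ncard :=
  hh.card_eq_ncard_polarizedComponents
    (fun k ↦ ((hPk k).isPolarizedIrreducible_iff_not_isPolarizedDecomposable (Ψ k)).1 (hirr k)) hη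

end Unique

/-! ### §3 The product itself: the polarised components of `(∏_k X_k, ⊞_k ω_k)` with indecomposable factors are
the axes -/

section Product

variable {κ : Type*} [Fintype κ] [DecidableEq κ] {σ : κ → Type*} [∀ k, Fintype (σ k)] [∀ k, DecidableEq (σ k)]
  {F : κ → Type*} [∀ k, NormedAddCommGroup (F k)] [∀ k, NormedSpace ℂ (F k)]
  (Ψ : ∀ k, (σ k → ℝ) ≃L[ℝ] F k) (ω : ∀ k, F k [⋀^Fin 2]→L[ℝ] ℝ)

/-- **The axis `0 × ⋯ × X_k × ⋯ × 0` of a product of polarised tori, with the restricted product form, is isomorphic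
to `(X_k, ω_k)`** (the factor isomorphism of A2-130 for `h = id`). [cite: Lange2023AbelianVarietiesComplex, §2.4.4 Cor. 2.4.24 and Cor. 2.4.31, pp. 123, 125] -/
theorem exists_isPolarizedIso_sigmaAxisSubspace (k : κ) :
    ∃ g : ComplexTorus (subtorusPeriod (sigmaPiPeriod Ψ) (sigmaAxisSubspace σ k)
        (isLatticeSubspace_sigmaAxisSubspace k) (isComplexSubspace_sigmaAxisSubspace Ψ k)) ≃+ ComplexTorus (Ψ k),
      IsPolarizedIso (subtorusPeriod (sigmaPiPeriod Ψ) (sigmaAxisSubspace σ k)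
          (isLatticeSubspace_sigmaAxisSubspace k) (isComplexSubspace_sigmaAxisSubspace Ψ k))
        (pullbackForm (cxSpan (sigmaPiPeriod Ψ) (sigmaAxisSubspace σ k)).subtypeL (piForm ω)) (Ψ k) (ω k) g := by
  have h1 : (1 : Matrix (Σ j, σ j) (Σ j, σ j) ℤ) * 1 = 1 := Matrix.mul_one 1
  have hC : ∀ x, sigmaPiPeriod Ψ (((1 : Matrix (Σ j, σ j) (Σ j, σ j) ℤ).map (Int.cast : ℤ → ℝ)) *ᵥ x) =
      (ContinuousLinearEquiv.refl ℂ (∀ j, F j)) (sigmaPiPeriod Ψ x) := fun x ↦ by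
    rw [Matrix.map_one _ Int.cast_zero Int.cast_one, Matrix.one_mulVec]; rfl
  have hmap : (sigmaAxisSubspace σ k).map
      (Matrix.toLin' ((1 : Matrix (Σ j, σ j) (Σ j, σ j) ℤ).map (Int.cast : ℤ → ℝ))) = sigmaAxisSubspace σ k := by
    rw [Matrix.map_one _ Int.cast_zero Int.cast_one, Matrix.toLin'_one, Submodule.map_id]
  have hU' : IsLatticeSubspace ((sigmaAxisSubspace σ k).map
      (Matrix.toLin' ((1 : Matrix (Σ j, σ j) (Σ j, σ j) ℤ).map (Int.cast : ℤ → ℝ)))) := by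
    rw [hmap]; exact isLatticeSubspace_sigmaAxisSubspace k
  have hUc' : IsComplexSubspace (sigmaPiPeriod Ψ) ((sigmaAxisSubspace σ k).map
      (Matrix.toLin' ((1 : Matrix (Σ j, σ j) (Σ j, σ j) ℤ).map (Int.cast : ℤ → ℝ)))) := by
    rw [hmap]; exact isComplexSubspace_sigmaAxisSubspace Ψ k
  obtain ⟨g, hg, -⟩ := exists_isPolarizedIso_factor_of_matrix (Φ := sigmaPiPeriod Ψ) (η := piForm ω) h1 h1
    (ContinuousLinearEquiv.refl ℂ (∀ j, F j)) hC (fun _ _ ↦ rfl) k hU' hUc'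
  obtain ⟨f₀, hf₀⟩ := exists_isPolarizedIso_subtorus_of_eq (η := piForm ω) hmap.symm
    (isLatticeSubspace_sigmaAxisSubspace k) (isComplexSubspace_sigmaAxisSubspace Ψ k) hU' hUc'
  exact ⟨_, hf₀.trans hg⟩

/-- **An axis of a product with an indecomposable factor `(X_k, ω_k)` (non-zero, not a product) is an indecomposable
member** (p26's `IsIndecomposable`) of `(∏_j X_j, ⊞_j ω_j)`. [cite: Debarre1996PolarisationsProduits, p. 631 («indécomposable») and Corollaire 2] -/
theorem isIndecomposable_sigmaAxisSubspace {k : κ} [Nonempty (σ k)] (hind : ¬ IsPolarizedDecomposable (Ψ k) (ω k)) :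
    IsIndecomposable (sigmaPiPeriod Ψ) (piForm ω) (sigmaAxisSubspace σ k) := by
  obtain ⟨g, hg⟩ := exists_isPolarizedIso_sigmaAxisSubspace Ψ ω k
  rw [isIndecomposable_iff_not_isPolarizedDecomposable (isLatticeSubspace_sigmaAxisSubspace k)
    (isComplexSubspace_sigmaAxisSubspace Ψ k)]
  exact ⟨sigmaAxisSubspace_ne_bot, fun hd ↦ hind (hg.isPolarizedDecomposable_iff.1 hd)⟩

/-- **THE POLARISED COMPONENTS OF A PRODUCT `(∏_k X_k, ⊞_k ω_k)` OF INDECOMPOSABLE POLARISED TORI ARE ITS AXES**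
(uniqueness of the decomposition into indecomposables, applied to the axis family).
[cite: Debarre1996PolarisationsProduits, Corollaire 2 b)] -/
theorem polarizedComponents_sigmaPi [∀ k, Nonempty (σ k)] (hind : ∀ k, ¬ IsPolarizedDecomposable (Ψ k) (ω k))
    (hω : ∀ k, IsRiemannForm (Ψ k) (ω k)) :
    polarizedComponents (sigmaPiPeriod Ψ) (piForm ω) = Set.range (sigmaAxisSubspace σ) :=
  ((isProductFamily_sigmaAxisSubspace Ψ ω).range_eq_polarizedComponents
    (fun _ ↦ isIndecomposable_sigmaAxisSubspace Ψ ω (hind _)) (IsRiemannForm.sigmaPi hω)).symm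

/-- **A product of `#κ` indecomposable polarised tori has exactly `#κ` polarised components.**
[cite: Debarre1996PolarisationsProduits, Corollaire 2 b)] [cite: ClemensGriffiths1972, §3 Cor. 3.23, p. 297] -/
theorem ncard_polarizedComponents_sigmaPi [∀ k, Nonempty (σ k)] (hind : ∀ k, ¬ IsPolarizedDecomposable (Ψ k) (ω k))
    (hω : ∀ k, IsRiemannForm (Ψ k) (ω k)) :
    (polarizedComponents (sigmaPiPeriod Ψ) (piForm ω)).ncard = Fintype.card κ :=
  ((IsPolarizedIso.refl (sigmaPiPeriod Ψ) (piForm ω)).card_eq_ncard_polarizedComponents hind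
    (IsRiemannForm.sigmaPi hω)).symm

/-- The same for a product of non-zero IRREDUCIBLE p.p.a.v.'s (Def. 3.22): `#polarizedComponents (∏_k 𝒯_k) = #κ` and
the components are the axes. [cite: ClemensGriffiths1972, §3 Def. 3.22 and Cor. 3.23, p. 297] -/
theorem polarizedComponents_sigmaPi_of_isPolarizedIrreducible [∀ k, Nonempty (σ k)]
    (hPk : ∀ k, IsPrincipalPolarization (Ψ k) (ω k)) (hirr : ∀ k, IsPolarizedIrreducible (Ψ k) (ω k)) :
    polarizedComponents (sigmaPiPeriod Ψ) (piForm ω) = Set.range (sigmaAxisSubspace σ) ∧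
      (polarizedComponents (sigmaPiPeriod Ψ) (piForm ω)).ncard = Fintype.card κ :=
  have hind := fun k ↦ ((hPk k).isPolarizedIrreducible_iff_not_isPolarizedDecomposable (Ψ k)).1 (hirr k)
  have hω := fun k ↦ (hPk k).isRiemannForm
  ⟨polarizedComponents_sigmaPi Ψ ω hind hω, ncard_polarizedComponents_sigmaPi Ψ ω hind hω⟩

end Product

end ComplexTorus

end Literature.Geometry.Kaehler
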